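import Summits.QuantumFields.YangMills.Theorems.LuscherReductionTwistedTraceScalingStepActionExact
import HarnessLib

/-!
# The transported kinetic step to SECOND order and the CUBIC part of the step action (rate twin of `stub_boRate`, RATE POINT 3)
# (route `FlatTubeReduction`, crux K1 `NearFlatRatioLaw` stmt-QuantumFields-24720, registered stub `stub_boRate` = FCL 23943's `BORateAll`; line «borate»;
# design notes `Cruxes/NearFlatRatioLaw/Lines/borate-rate-uniformity-g7.md` (O5), `Cruxes/FixedLatticeLaw/Lines/rate.md` RATE POINT 3; rung R2b1 = RECORD label)

Seat `ym-line-ftr-p1` g7 (prover).  Route RED lane A/B expand the Wilson action along a kinetic step `V = W·U` to QUADRATIC order in the transported step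
(`…StepActionExact.abs_wilsonAction_step_sub_quadratic_le`: error `N_P(1728τ²√σ + 29376τ³ + 700569τ⁴)`), which is `o(λ_b)` after multiplication by `β`
(`βτ³ ≍ β^{-1/2}`) but NOT `O(λ_b²) = O(β^{-2/3})`.  The rate twin of the Born–Oppenheimer package must keep the CUBIC terms explicit — they are ODD under the
reflection of the step (and of the curvature) and therefore cost nothing on the diagonal block (`KernelParity`, p632175 / `…KernelParityExp`) — and pay only the
QUARTIC remainder `β(τ⁴ + τ³√σ) = O(β^{-1}·polylog)`.  This file supplies the quaternion algebra, on top of lane B's `…QuaternionStep`: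
* ★ `abs_vecPart_mul_sub_sub_cross_le` — two near-identity factors to second order: `vecPart(AB) = a + b + a × b + O(α²β + β²α)` (componentwise, explicit `3α²β + 3β²α`);
* ★★ `abs_vecPart_prod4_sub_sum_sub_cross_le` — four factors: `vecPart(A₁A₂A₃A₄) = Σᵢ aᵢ + Σ_{i<j} aᵢ × aⱼ + O(t³)` (explicit `170t³` for `|aᵢ|_c ≤ t ≤ 1/10`);
* ★★ `abs_stepIncrement_sub_cubic_le` — the plaquette increment `2(1 − u₀X)u₀(H) + 2x·F_H` (EXACT form of `S_p(W·U) − S_p(U)`, `…StepActionExact.plaqTerm_step_eq`) equals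
  `[2 s·F + u₀(H)|s|²] + [2 q·F + 2u₀(H) s·q] + O(t⁴ + t³φ)` with `s = Σaᵢ` (= the covariant curl `(D_U w)_p`, `sum_vecPart_factors_eq_covCurl`), `q = Σ_{i<j} aᵢ × aⱼ`,
  `|F_H|_c ≤ φ`: the bracket `[2q·F + 2u₀(H)s·q]` is the CUBIC part — even in nothing, odd under `(aᵢ, F) ↦ (−aᵢ, −F)`;
* `cross_neg_neg` — `(−a) × (−b) = a × b`: the second-order term `q` is EVEN under the reflection of the step (parity bookkeeping for `KernelParity`).
HONEST FRAMING: quaternion algebra on a fixed lattice; a helper for the registered stub of a crux of the CONDITIONAL reduction route to the femto rung R2b1 (RECORD label);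
no spectral claim; the chart in which these expansions are used is route RED lane A's (C4-CORE, OPEN); nothing here is infinite volume, a continuum limit or the Clay
mass gap.  No summit statement is proved.

## References
* M. Lüscher, Nucl. Phys. B219 (1983) 233, §3 (expansion of the plaquette action around a slow background; parity of the cubic vertex) — [cite: Luscher1983, §3].
* T. Bröcker, T. tom Dieck, *Representations of Compact Lie Groups*, Springer GTM 98 (1985), I (1.10) (quaternion multiplication) — [cite: BrockerTomDieck1985, I (1.10)].
-/

set_option autoImplicit false

noncomputable section

open scoped Matrix BigOperators
open Literature.MathematicalPhysics.QuantumFieldTheory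
open Literature.MathematicalPhysics.QuantumLattice

namespace Summit.QuantumFields.YangMills.Theorems.FemtoTransferGap.StepCubic

open Summit.QuantumFields.YangMills.Theorems.FemtoTransferGap
open Summit.QuantumFields.YangMills.Theorems.FemtoTransferGap.TwoLattice
open Summit.QuantumFields.YangMills.Theorems.FemtoTransferGap.TwoLattice.Stiff
open Summit.QuantumFields.YangMills.Theorems.FemtoTransferGap.TwoLattice.Cov

/-! ## §1 Two near-identity factors to second order -/

/-- ★ **Two near-identity factors to SECOND order**: `u₀(A), u₀(B) ≥ 0`, `|a_i| ≤ α`, `|b_i| ≤ β` ⇒ for every colour `c`,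
`|vecPart(AB)_c − a_c − b_c − (a × b)_c| ≤ 3α²β + 3β²α` — the cross product is the exact second-order term, the remainder is cubic.
[cite: BrockerTomDieck1985, I (1.10)] -/
theorem abs_vecPart_mul_sub_sub_cross_le {A B : SU2} (hA : 0 ≤ scalarPart A) (hB : 0 ≤ scalarPart B) {α β : ℝ}
    (ha : ∀ i, |vecPart A i| ≤ α) (hb : ∀ i, |vecPart B i| ≤ β) (c : Fin 3) :
    |vecPart (A * B) c - vecPart A c - vecPart B c - (vecPart A ⨯₃ vecPart B) c| ≤ 3 * α ^ 2 * β + 3 * β ^ 2 * α := by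
  have hα : 0 ≤ α := (abs_nonneg _).trans (ha 0)
  have hβ : 0 ≤ β := (abs_nonneg _).trans (hb 0)
  obtain ⟨hA0, hA1⟩ := one_sub_scalarPart_le_of_abs_le hA ha
  obtain ⟨hB0, hB1⟩ := one_sub_scalarPart_le_of_abs_le hB hb
  have h := congrFun (vecPart_mul_sub A B) c
  simp only [Pi.sub_apply, Pi.add_apply, Pi.smul_apply, smul_eq_mul] at h
  have e : vecPart (A * B) c - vecPart A c - vecPart B c - (vecPart A ⨯₃ vecPart B) c =
      (scalarPart A - 1) * vecPart B c + (scalarPart B - 1) * vecPart A c := by linarith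
  rw [e]
  have h1 : |(scalarPart A - 1) * vecPart B c| ≤ 3 * α ^ 2 * β := by
    rw [abs_mul, abs_sub_comm, abs_of_nonneg hA0]
    exact mul_le_mul hA1 (hb c) (abs_nonneg _) (by positivity)
  have h2 : |(scalarPart B - 1) * vecPart A c| ≤ 3 * β ^ 2 * α := by
    rw [abs_mul, abs_sub_comm, abs_of_nonneg hB0]
    exact mul_le_mul hB1 (ha c) (abs_nonneg _) (by positivity)
  exact (abs_add_le _ _).trans (add_le_add h1 h2)

/-- `(−a) × (−b) = a × b`: the second-order term is EVEN under the reflection of the step. [folklore] -/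
theorem cross_neg_neg (a b : Fin 3 → ℝ) : (-a) ⨯₃ (-b) = a ⨯₃ b := by
  simp only [map_neg, LinearMap.neg_apply, neg_neg]

/-- Componentwise size of a vector from componentwise sizes of its summands (bookkeeping). [folklore] -/
theorem abs_add_apply_le {u v : Fin 3 → ℝ} {μ ν : ℝ} (hu : ∀ i, |u i| ≤ μ) (hv : ∀ i, |v i| ≤ ν) (i : Fin 3) :
    |(u + v) i| ≤ μ + ν := by
  rw [Pi.add_apply]; exact (abs_add_le _ _).trans (add_le_add (hu i) (hv i))

/-! ## §2 Four near-identity factors to second order -/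

/-- ★★ **Four near-identity factors to SECOND order** (the transported step `X_p`): if `u₀(Aᵢ) ≥ 0` and `|vecPart(Aᵢ)_c| ≤ t ≤ 1/10`, then for every colour
`c`, with `aᵢ = vecPart Aᵢ`:
`|vecPart(A₁A₂A₃A₄)_c − (a₁+a₂+a₃+a₄)_c − (a₁×a₂ + a₁×a₃ + a₁×a₄ + a₂×a₃ + a₂×a₄ + a₃×a₄)_c| ≤ 170·t³`.
[cite: BrockerTomDieck1985, I (1.10)] [cite: Luscher1983, §3] -/
theorem abs_vecPart_prod4_sub_sum_sub_cross_le {A₁ A₂ A₃ A₄ : SU2} (h₁ : 0 ≤ scalarPart A₁) (h₂ : 0 ≤ scalarPart A₂)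
    (h₃ : 0 ≤ scalarPart A₃) (h₄ : 0 ≤ scalarPart A₄) {t : ℝ} (ht : t ≤ 1 / 10) (ha₁ : ∀ i, |vecPart A₁ i| ≤ t)
    (ha₂ : ∀ i, |vecPart A₂ i| ≤ t) (ha₃ : ∀ i, |vecPart A₃ i| ≤ t) (ha₄ : ∀ i, |vecPart A₄ i| ≤ t) (c : Fin 3) :
    |vecPart (A₁ * (A₂ * (A₃ * A₄))) c - (vecPart A₁ + vecPart A₂ + vecPart A₃ + vecPart A₄) c
        - (vecPart A₁ ⨯₃ vecPart A₂ + vecPart A₁ ⨯₃ vecPart A₃ + vecPart A₁ ⨯₃ vecPart A₄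
            + vecPart A₂ ⨯₃ vecPart A₃ + vecPart A₂ ⨯₃ vecPart A₄ + vecPart A₃ ⨯₃ vecPart A₄) c| ≤ 170 * t ^ 3 := by
  have ht0 : 0 ≤ t := (abs_nonneg _).trans (ha₁ 0)
  set a₁ := vecPart A₁ with ha₁d
  set a₂ := vecPart A₂ with ha₂d
  set a₃ := vecPart A₃ with ha₃d
  set a₄ := vecPart A₄ with ha₄d
  -- step 1: B₁ = A₃A₄, b₁ = a₃ + a₄ + a₃×a₄ + r₁
  set b₁ := vecPart (A₃ * A₄) with hb₁d
  set r₁ : Fin 3 → ℝ := b₁ - a₃ - a₄ - a₃ ⨯₃ a₄ with hr₁d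
  have hr₁ : ∀ i, |r₁ i| ≤ 6 * t ^ 3 := fun i => by
    have := abs_vecPart_mul_sub_sub_cross_le h₃ h₄ ha₃ ha₄ i
    simp only [hr₁d, Pi.sub_apply]
    linarith
  have hb₁ : ∀ i, |b₁ i| ≤ 3 * t := fun i => by
    have := abs_vecPart_mul_le h₃ h₄ ha₃ ha₄ i; nlinarith
  have s₁ : 0 ≤ scalarPart (A₃ * A₄) := by
    have := (abs_vecPart_mul_sub_le h₃ h₄ ha₃ ha₄).2; nlinarith
  -- step 2: B₂ = A₂B₁, b₂ = a₂ + b₁ + a₂×b₁ + r₂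
  set b₂ := vecPart (A₂ * (A₃ * A₄)) with hb₂d
  set r₂ : Fin 3 → ℝ := b₂ - a₂ - b₁ - a₂ ⨯₃ b₁ with hr₂d
  have hr₂ : ∀ i, |r₂ i| ≤ 36 * t ^ 3 := fun i => by
    have := abs_vecPart_mul_sub_sub_cross_le h₂ s₁ ha₂ hb₁ i
    simp only [hr₂d, Pi.sub_apply]
    linarith
  have hb₂ : ∀ i, |b₂ i| ≤ 5 * t := fun i => by
    have := abs_vecPart_mul_le h₂ s₁ ha₂ hb₁ i; nlinarith
  have s₂ : 0 ≤ scalarPart (A₂ * (A₃ * A₄)) := by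
    have := (abs_vecPart_mul_sub_le h₂ s₁ ha₂ hb₁).2; nlinarith
  -- step 3: X = A₁B₂, x = a₁ + b₂ + a₁×b₂ + r₃
  set x := vecPart (A₁ * (A₂ * (A₃ * A₄))) with hxd
  set r₃ : Fin 3 → ℝ := x - a₁ - b₂ - a₁ ⨯₃ b₂ with hr₃d
  have hr₃ : ∀ i, |r₃ i| ≤ 90 * t ^ 3 := fun i => by
    have := abs_vecPart_mul_sub_sub_cross_le h₁ s₂ ha₁ hb₂ i
    simp only [hr₃d, Pi.sub_apply]
    linarith
  -- the deviations of b₁, b₂ from the plain sums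
  set d₁ : Fin 3 → ℝ := b₁ - a₃ - a₄ with hd₁d
  have hd₁e : d₁ = a₃ ⨯₃ a₄ + r₁ := by simp only [hd₁d, hr₁d]; abel
  have hd₁ : ∀ i, |d₁ i| ≤ 2 * t * t + 6 * t ^ 3 := fun i => by
    rw [hd₁e]; exact abs_add_apply_le (abs_cross_apply_le ha₃ ha₄) hr₁ i
  set d₂ : Fin 3 → ℝ := b₂ - a₂ - a₃ - a₄ with hd₂d
  have hd₂e : d₂ = (a₂ ⨯₃ b₁ + r₂) + d₁ := by simp only [hd₂d, hr₂d, hd₁d]; abel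
  have hd₂ : ∀ i, |d₂ i| ≤ (2 * t * (3 * t) + 36 * t ^ 3) + (2 * t * t + 6 * t ^ 3) := fun i => by
    rw [hd₂e]; exact abs_add_apply_le (abs_add_apply_le (abs_cross_apply_le ha₂ hb₁) hr₂) hd₁ i
  -- cross products with the deviations are cubic
  have hc₂ : ∀ i, |(a₂ ⨯₃ d₁) i| ≤ 2 * t * (2 * t * t + 6 * t ^ 3) := abs_cross_apply_le ha₂ hd₁
  have hc₁ : ∀ i, |(a₁ ⨯₃ d₂) i| ≤ 2 * t * ((2 * t * (3 * t) + 36 * t ^ 3) + (2 * t * t + 6 * t ^ 3)) := abs_cross_apply_le ha₁ hd₂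
  -- the exact decomposition of the total remainder
  have key : x - (a₁ + a₂ + a₃ + a₄) - (a₁ ⨯₃ a₂ + a₁ ⨯₃ a₃ + a₁ ⨯₃ a₄ + a₂ ⨯₃ a₃ + a₂ ⨯₃ a₄ + a₃ ⨯₃ a₄)
      = r₁ + r₂ + r₃ + a₂ ⨯₃ d₁ + a₁ ⨯₃ d₂ := by
    have e₂ : a₂ ⨯₃ b₁ = a₂ ⨯₃ a₃ + a₂ ⨯₃ a₄ + a₂ ⨯₃ d₁ := by
      have : b₁ = a₃ + a₄ + d₁ := by simp only [hd₁d]; abel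
      rw [this, map_add, map_add]
    have e₁ : a₁ ⨯₃ b₂ = a₁ ⨯₃ a₂ + a₁ ⨯₃ a₃ + a₁ ⨯₃ a₄ + a₁ ⨯₃ d₂ := by
      have : b₂ = a₂ + a₃ + a₄ + d₂ := by simp only [hd₂d]; abel
      rw [this, map_add, map_add, map_add]
    simp only [hr₁d, hr₂d, hr₃d, hd₁d, hd₂d] at e₁ e₂ ⊢
    rw [e₁, e₂]
    abel
  have keyc := congrFun key c
  simp only [Pi.sub_apply, Pi.add_apply] at keyc ⊢
  rw [keyc]
  have t1 := abs_add_le (r₁ c + r₂ c + r₃ c + (a₂ ⨯₃ d₁) c) ((a₁ ⨯₃ d₂) c)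
  have t2 := abs_add_le (r₁ c + r₂ c + r₃ c) ((a₂ ⨯₃ d₁) c)
  have t3 := abs_add_le (r₁ c + r₂ c) (r₃ c)
  have t4 := abs_add_le (r₁ c) (r₂ c)
  have k4 : t ^ 4 ≤ t ^ 3 / 10 := by nlinarith [pow_nonneg ht0 3]
  nlinarith [hr₁ c, hr₂ c, hr₃ c, hc₂ c, hc₁ c, k4, pow_nonneg ht0 3]

/-! ## §3 The plaquette increment to CUBIC order -/

/-- ★★ **The plaquette increment to CUBIC order.**  Let `X = A₁A₂A₃A₄` be a product of four near-identity factors (`u₀(Aᵢ) ≥ 0`, `|vecPart(Aᵢ)_c| ≤ t ≤ 1/10`),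
`H` a holonomy with `u₀(H) ≥ 0` and `|vecPart(H)_c| ≤ φ`, and put `s = Σᵢ aᵢ`, `q = Σ_{i<j} aᵢ × aⱼ` (`aᵢ = vecPart Aᵢ`).  Then the EXACT plaquette increment
`2(1 − u₀X)·u₀(H) + 2·vecPart(X)·vecPart(H)` (`= S_p(W·U) − S_p(U)` by `…StepActionExact.plaqTerm_step_eq`) satisfies
`|increment − [2 s·F + u₀(H)|s|²] − [2 q·F + 2u₀(H) s·q]| ≤ 15300·t⁴ + 1020·t³·φ` (`F = vecPart H`):
QUADRATIC part (lane A's model) + explicit CUBIC part + quartic remainder. [cite: Luscher1983, §3] [cite: BrockerTomDieck1985, I (1.10)] -/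
theorem abs_stepIncrement_sub_cubic_le {A₁ A₂ A₃ A₄ H : SU2} (h₁ : 0 ≤ scalarPart A₁) (h₂ : 0 ≤ scalarPart A₂)
    (h₃ : 0 ≤ scalarPart A₃) (h₄ : 0 ≤ scalarPart A₄) (hH : 0 ≤ scalarPart H) {t φ : ℝ} (ht : t ≤ 1 / 10)
    (ha₁ : ∀ i, |vecPart A₁ i| ≤ t) (ha₂ : ∀ i, |vecPart A₂ i| ≤ t) (ha₃ : ∀ i, |vecPart A₃ i| ≤ t) (ha₄ : ∀ i, |vecPart A₄ i| ≤ t)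
    (hF : ∀ i, |vecPart H i| ≤ φ) (s q : Fin 3 → ℝ) (hs : s = vecPart A₁ + vecPart A₂ + vecPart A₃ + vecPart A₄)
    (hq : q = vecPart A₁ ⨯₃ vecPart A₂ + vecPart A₁ ⨯₃ vecPart A₃ + vecPart A₁ ⨯₃ vecPart A₄
            + vecPart A₂ ⨯₃ vecPart A₃ + vecPart A₂ ⨯₃ vecPart A₄ + vecPart A₃ ⨯₃ vecPart A₄) :
    |(2 * (1 - scalarPart (A₁ * (A₂ * (A₃ * A₄)))) * scalarPart H + 2 * (vecPart (A₁ * (A₂ * (A₃ * A₄))) ⬝ᵥ vecPart H))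
        - (2 * (s ⬝ᵥ vecPart H) + scalarPart H * (s ⬝ᵥ s))
        - (2 * (q ⬝ᵥ vecPart H) + 2 * scalarPart H * (s ⬝ᵥ q))| ≤ 15300 * t ^ 4 + 1020 * t ^ 3 * φ := by
  have ht0 : 0 ≤ t := (abs_nonneg _).trans (ha₁ 0)
  have hφ0 : 0 ≤ φ := (abs_nonneg _).trans (hF 0)
  set X := A₁ * (A₂ * (A₃ * A₄)) with hXd
  set x := vecPart X with hxd
  set F := vecPart H with hFd
  set cH := scalarPart H with hcH
  -- the remainder of the second-order expansion
  set r : Fin 3 → ℝ := x - s - q with hrd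
  have hr : ∀ i, |r i| ≤ 170 * t ^ 3 := fun i => by
    have h := abs_vecPart_prod4_sub_sum_sub_cross_le h₁ h₂ h₃ h₄ ht ha₁ ha₂ ha₃ ha₄ i
    simp only [hrd, hs, hq, Pi.sub_apply]
    exact h
  -- sizes
  have hsb : ∀ i, |s i| ≤ 4 * t := fun i => by
    rw [hs]; simp only [Pi.add_apply]
    have := abs_add_le (vecPart A₁ i + vecPart A₂ i + vecPart A₃ i) (vecPart A₄ i)
    have := abs_add_le (vecPart A₁ i + vecPart A₂ i) (vecPart A₃ i)
    have := abs_add_le (vecPart A₁ i) (vecPart A₂ i)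
    linarith [ha₁ i, ha₂ i, ha₃ i, ha₄ i]
  have hqb : ∀ i, |q i| ≤ 12 * t ^ 2 := fun i => by
    rw [hq]
    have c12 := abs_cross_apply_le ha₁ ha₂ i
    have c13 := abs_cross_apply_le ha₁ ha₃ i
    have c14 := abs_cross_apply_le ha₁ ha₄ i
    have c23 := abs_cross_apply_le ha₂ ha₃ i
    have c24 := abs_cross_apply_le ha₂ ha₄ i
    have c34 := abs_cross_apply_le ha₃ ha₄ i
    simp only [Pi.add_apply]
    have := abs_add_le ((vecPart A₁ ⨯₃ vecPart A₂) i + (vecPart A₁ ⨯₃ vecPart A₃) i + (vecPart A₁ ⨯₃ vecPart A₄) i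
      + (vecPart A₂ ⨯₃ vecPart A₃) i + (vecPart A₂ ⨯₃ vecPart A₄) i) ((vecPart A₃ ⨯₃ vecPart A₄) i)
    have := abs_add_le ((vecPart A₁ ⨯₃ vecPart A₂) i + (vecPart A₁ ⨯₃ vecPart A₃) i + (vecPart A₁ ⨯₃ vecPart A₄) i
      + (vecPart A₂ ⨯₃ vecPart A₃) i) ((vecPart A₂ ⨯₃ vecPart A₄) i)
    have := abs_add_le ((vecPart A₁ ⨯₃ vecPart A₂) i + (vecPart A₁ ⨯₃ vecPart A₃) i + (vecPart A₁ ⨯₃ vecPart A₄) i)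
      ((vecPart A₂ ⨯₃ vecPart A₃) i)
    have := abs_add_le ((vecPart A₁ ⨯₃ vecPart A₂) i + (vecPart A₁ ⨯₃ vecPart A₃) i) ((vecPart A₁ ⨯₃ vecPart A₄) i)
    have := abs_add_le ((vecPart A₁ ⨯₃ vecPart A₂) i) ((vecPart A₁ ⨯₃ vecPart A₃) i)
    nlinarith
  have hqr : ∀ i, |(q + r) i| ≤ 29 * t ^ 2 := fun i => by
    have := abs_add_apply_le hqb hr i; nlinarith
  -- dot products
  have d1 : |s ⬝ᵥ r| ≤ 3 * (4 * t) * (170 * t ^ 3) := abs_dot_le hsb hr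
  have d2 : |(q + r) ⬝ᵥ (q + r)| ≤ 3 * (29 * t ^ 2) * (29 * t ^ 2) := abs_dot_le hqr hqr
  have d3 : |r ⬝ᵥ F| ≤ 3 * (170 * t ^ 3) * φ := abs_dot_le hr hF
  -- scalar parts
  obtain ⟨-, -, sX, aX⟩ := abs_vecPart_prod4_sub_sum_le h₁ h₂ h₃ h₄ ht ha₁ ha₂ ha₃ ha₄
  have hcH1 : cH ≤ 1 := by
    have h := scalarPart_sq_add H
    have h2 : 0 ≤ ∑ a, vecPart H a ^ 2 := Finset.sum_nonneg fun a _ => sq_nonneg _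
    nlinarith
  have h0X : 0 ≤ 1 - scalarPart X := by
    have h := scalarPart_sq_add X
    have h2 : 0 ≤ ∑ a, vecPart X a ^ 2 := Finset.sum_nonneg fun a _ => sq_nonneg _
    nlinarith
  have hquad : 2 * (1 - scalarPart X) = x ⬝ᵥ x + (1 - scalarPart X) ^ 2 := by
    rw [two_mul_one_sub_scalarPart_eq X]
    simp only [dotProduct, hxd, sq]
  -- exact decomposition
  have hsplit : (2 * (1 - scalarPart X) * cH + 2 * (x ⬝ᵥ F)) - (2 * (s ⬝ᵥ F) + cH * (s ⬝ᵥ s)) - (2 * (q ⬝ᵥ F) + 2 * cH * (s ⬝ᵥ q))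
      = cH * (2 * (s ⬝ᵥ r) + (q + r) ⬝ᵥ (q + r)) + cH * (1 - scalarPart X) ^ 2 + 2 * (r ⬝ᵥ F) := by
    rw [hquad]
    simp only [hrd, dotProduct, Pi.add_apply, Pi.sub_apply, Fin.sum_univ_three]
    ring
  rw [hsplit]
  have t1 : |cH * (2 * (s ⬝ᵥ r) + (q + r) ⬝ᵥ (q + r))| ≤ 2 * (3 * (4 * t) * (170 * t ^ 3)) + 3 * (29 * t ^ 2) * (29 * t ^ 2) := by
    rw [abs_mul, abs_of_nonneg hH]
    have := abs_add_le (2 * (s ⬝ᵥ r)) ((q + r) ⬝ᵥ (q + r))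
    have h2 : |2 * (s ⬝ᵥ r)| ≤ 2 * (3 * (4 * t) * (170 * t ^ 3)) := by rw [abs_mul, abs_two]; linarith
    calc cH * |2 * (s ⬝ᵥ r) + (q + r) ⬝ᵥ (q + r)| ≤ 1 * (2 * (3 * (4 * t) * (170 * t ^ 3)) + 3 * (29 * t ^ 2) * (29 * t ^ 2)) :=
          mul_le_mul hcH1 (by linarith) (abs_nonneg _) zero_le_one
      _ = _ := one_mul _
  have t2 : |cH * (1 - scalarPart X) ^ 2| ≤ (93 * t ^ 2) ^ 2 := by
    rw [abs_mul, abs_of_nonneg hH, abs_of_nonneg (sq_nonneg _)]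
    calc cH * (1 - scalarPart X) ^ 2 ≤ 1 * (93 * t ^ 2) ^ 2 := mul_le_mul hcH1 (pow_le_pow_left₀ h0X aX 2) (sq_nonneg _) zero_le_one
      _ = _ := one_mul _
  have t3 : |2 * (r ⬝ᵥ F)| ≤ 2 * (3 * (170 * t ^ 3) * φ) := by rw [abs_mul, abs_two]; linarith
  have := abs_add_le (cH * (2 * (s ⬝ᵥ r) + (q + r) ⬝ᵥ (q + r)) + cH * (1 - scalarPart X) ^ 2) (2 * (r ⬝ᵥ F))
  have := abs_add_le (cH * (2 * (s ⬝ᵥ r) + (q + r) ⬝ᵥ (q + r))) (cH * (1 - scalarPart X) ^ 2)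
  nlinarith [pow_nonneg ht0 4, pow_nonneg ht0 3, hφ0]

/-! ## §4 Lattice packaging: the transported step of a kinetic step `W` at the row point `U` -/

variable {L : ℕ} [NeZero L]

/-- **The second-order part of the transported step**: `Q_p(W;U) = Σ_{i<j} aᵢ × aⱼ` over the vector parts of the four factors of `X_p(W;U)`
(`a₁ = w(e₁)`, `a₂ = Ad(P₁)w(e₂)`, `a₃ = −Ad(P₂)w(e₃)`, `a₄ = −Ad(hol_p U)w(e₄)`, cf. `…CovariantCurl.transportStep`, `sum_vecPart_factors_eq_covCurl`) —
an explicit QUADRATIC form in the step `w = vecPart ∘ W` with `U`-dependent (transport) coefficients. [cite: Luscher1983, §3] -/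
def transportCross (W U : GaugeConfig 3 L SU2) (p : Plaquette 3 L) : Fin 3 → ℝ :=
  let a₁ : Fin 3 → ℝ := vecPart (W (p.1, p.2.1.1))
  let a₂ : Fin 3 → ℝ := (adRot (ptrans1 U p)).mulVec (vecPart (W (p.1.shift p.2.1.1, p.2.1.2)))
  let a₃ : Fin 3 → ℝ := -((adRot (ptrans2 U p)).mulVec (vecPart (W (p.1.shift p.2.1.2, p.2.1.1))))
  let a₄ : Fin 3 → ℝ := -((adRot (hol U p)).mulVec (vecPart (W (p.1, p.2.1.2))))
  a₁ ⨯₃ a₂ + a₁ ⨯₃ a₃ + a₁ ⨯₃ a₄ + a₂ ⨯₃ a₃ + a₂ ⨯₃ a₄ + a₃ ⨯₃ a₄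

omit [NeZero L] in
/-- ★ **Parity**: `Q_p(W⁻¹;U) = Q_p(W;U)` — reversing the step (`W ↦ W⁻¹` linkwise, which flips every factor's vector part) leaves the second-order term
invariant; together with the linearity of the covariant curl (`D_U(−w) = −D_U w`) this is the ODD/EVEN bookkeeping the kernel-parity lemma consumes. [folklore] -/
theorem transportCross_inv (W U : GaugeConfig 3 L SU2) (p : Plaquette 3 L) : transportCross W⁻¹ U p = transportCross W U p := by
  simp only [transportCross, Pi.inv_apply, vecPart_inv, Matrix.mulVec_neg, map_neg, LinearMap.neg_apply, neg_neg]

/-- ★★ **Per-plaquette CUBIC expansion of the step action.**  For link steps in the upper hemisphere with components `≤ τ ≤ 1/30` and a row point with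
`S(U) ≤ σ < 2` (`w = linkVec W`, `D = covCurl U w`, `F = plaqCurv U`, `c_p = u₀(hol_p U)`, `Q_p = transportCross W U p`):
`|[S_p(W·U) − S_p(U)] − [2Σ_c D_{p,c}F_{p,c} + c_p Σ_c D_{p,c}²] − [2 Q_p·F_p + 2c_p Σ_c D_{p,c} Q_{p,c}]| ≤ 1239300·τ⁴ + 27540·τ³·√σ`
(the first bracket in its exact form `2(1 − u₀X_p)c_p + 2x_p·F_p`, `…StepActionExact.plaqTerm_step_eq`). [cite: Luscher1983, §3] -/
theorem abs_plaqIncrement_sub_cubic_le (W U : GaugeConfig 3 L SU2) {τ σ : ℝ} (hτ : τ ≤ 1 / 30) (hσ : σ < 2)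
    (hS : wilsonAction su2Rep U ≤ σ) (hs : ∀ e : Edge 3 L, 0 ≤ scalarPart (W e)) (hw : ∀ (e : Edge 3 L) (c : Fin 3), |vecPart (W e) c| ≤ τ)
    (p : Plaquette 3 L) :
    |(2 * (1 - scalarPart (transportStep W U p)) * scalarPart (hol U p) + 2 * (vecPart (transportStep W U p) ⬝ᵥ vecPart (hol U p)))
        - (2 * ∑ c, covCurl U (linkVec L W) (p, c) * plaqCurv U (p, c) + scalarPart (hol U p) * ∑ c, covCurl U (linkVec L W) (p, c) ^ 2)
        - (2 * (transportCross W U p ⬝ᵥ vecPart (hol U p))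
            + 2 * scalarPart (hol U p) * ∑ c, covCurl U (linkVec L W) (p, c) * transportCross W U p c)|
      ≤ 1239300 * τ ^ 4 + 27540 * τ ^ 3 * Real.sqrt σ := by
  set A₁ := W (p.1, p.2.1.1) with hA₁
  set A₂ := ptrans1 U p * W (p.1.shift p.2.1.1, p.2.1.2) * (ptrans1 U p)⁻¹ with hA₂
  set A₃ := (ptrans2 U p * W (p.1.shift p.2.1.2, p.2.1.1) * (ptrans2 U p)⁻¹)⁻¹ with hA₃
  set A₄ := (hol U p * W (p.1, p.2.1.2) * (hol U p)⁻¹)⁻¹ with hA₄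
  have hX : transportStep W U p = A₁ * (A₂ * (A₃ * A₄)) := by
    simp only [transportStep, hA₁, hA₂, hA₃, hA₄, mul_assoc]
  have h1s : 0 ≤ scalarPart A₁ := hs _
  have h1v : ∀ b, |vecPart A₁ b| ≤ 3 * τ := fun b => (hw _ b).trans (by linarith [(abs_nonneg _).trans (hw (p.1, p.2.1.1) 0)])
  obtain ⟨h2s, h2v⟩ := conj_factor_bounds (ptrans1 U p) (W (p.1.shift p.2.1.1, p.2.1.2)) (hs _) (hw _)
  obtain ⟨h3s, h3v⟩ := conj_inv_factor_bounds (ptrans2 U p) (W (p.1.shift p.2.1.2, p.2.1.1)) (hs _) (hw _)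
  obtain ⟨h4s, h4v⟩ := conj_inv_factor_bounds (hol U p) (W (p.1, p.2.1.2)) (hs _) (hw _)
  obtain ⟨hH, hF⟩ := hol_hypotheses_of_wilsonAction_le U hσ hS p
  have ht : 3 * τ ≤ 1 / 10 := by linarith
  -- the factor vector parts, the linear part `s = D_U w (p, ·)` and the quadratic part `q = Q_p`
  set s : Fin 3 → ℝ := vecPart A₁ + vecPart A₂ + vecPart A₃ + vecPart A₄ with hsd
  have hsD : ∀ c, s c = covCurl U (linkVec L W) (p, c) := fun c => by
    simp only [hsd, Pi.add_apply, hA₁, hA₂, hA₃, hA₄]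
    exact sum_vecPart_factors_eq_covCurl W U p c
  have hq : transportCross W U p = vecPart A₁ ⨯₃ vecPart A₂ + vecPart A₁ ⨯₃ vecPart A₃ + vecPart A₁ ⨯₃ vecPart A₄
      + vecPart A₂ ⨯₃ vecPart A₃ + vecPart A₂ ⨯₃ vecPart A₄ + vecPart A₃ ⨯₃ vecPart A₄ := by
    simp only [transportCross, hA₁, hA₂, hA₃, hA₄, vecPart_conj, vecPart_conj_inv]
  have key := abs_stepIncrement_sub_cubic_le h1s h2s h3s h4s hH ht h1v h2v h3v h4v hF s (transportCross W U p) rfl hq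
  -- rewrite the dot products with `s` as the sums over colours with `D`
  have e1 : s ⬝ᵥ vecPart (hol U p) = ∑ c, covCurl U (linkVec L W) (p, c) * plaqCurv U (p, c) := by
    simp only [dotProduct, plaqCurv_apply]; exact Finset.sum_congr rfl fun c _ => by rw [hsD c]
  have e2 : s ⬝ᵥ s = ∑ c, covCurl U (linkVec L W) (p, c) ^ 2 := by
    simp only [dotProduct]; exact Finset.sum_congr rfl fun c _ => by rw [hsD c, sq]
  have e3 : s ⬝ᵥ transportCross W U p = ∑ c, covCurl U (linkVec L W) (p, c) * transportCross W U p c := by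
    simp only [dotProduct]; exact Finset.sum_congr rfl fun c _ => by rw [hsD c]
  rw [hX, ← e1, ← e2, ← e3]
  refine key.trans ?_
  have hτ0 : 0 ≤ τ := (abs_nonneg _).trans (hw (p.1, p.2.1.1) 0)
  have hsq : 0 ≤ Real.sqrt σ := Real.sqrt_nonneg σ
  nlinarith [pow_nonneg hτ0 4, pow_nonneg hτ0 3]

/-- ★★ **CUBIC expansion of the Wilson action along a kinetic step** (rate grade).  Under the hypotheses of lane A's `abs_wilsonAction_step_sub_quadratic_le`
(`S(U) ≤ σ < 2`, steps in the upper hemisphere with components `≤ τ ≤ 1/30`):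
`|S(W·U) − S(U) − 2Σ_{p,c}D_{p,c}F_{p,c} − Σ_p c_pΣ_c D_{p,c}² − Σ_p (2 Q_p·F_p + 2 c_p Σ_c D_{p,c}Q_{p,c})| ≤ N_P·(1239300·τ⁴ + 27540·τ³√σ)` —
the CUBIC term is explicit and the remainder is QUARTIC: with `τ ≍ β^{-1/2}·polylog`, `√σ ≍ β^{-1/2}` the remainder times `β` is `O(β^{-1}·polylog)`, inside the
`λ_b²` budget, whereas lane A's quadratic-grade error `β·N_P(1728τ²√σ + 29376τ³) ≍ β^{-1/2}` is not. [cite: Luscher1983, §3] -/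
theorem abs_wilsonAction_step_sub_cubic_le (W U : GaugeConfig 3 L SU2) {τ σ : ℝ} (hτ : τ ≤ 1 / 30) (hσ : σ < 2)
    (hS : wilsonAction su2Rep U ≤ σ) (hs : ∀ e : Edge 3 L, 0 ≤ scalarPart (W e)) (hw : ∀ (e : Edge 3 L) (c : Fin 3), |vecPart (W e) c| ≤ τ) :
    |wilsonAction su2Rep (W * U) - wilsonAction su2Rep U
        - 2 * ∑ p : Plaquette 3 L, ∑ c, covCurl U (linkVec L W) (p, c) * plaqCurv U (p, c)
        - ∑ p : Plaquette 3 L, scalarPart (hol U p) * ∑ c, covCurl U (linkVec L W) (p, c) ^ 2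
        - ∑ p : Plaquette 3 L, (2 * (transportCross W U p ⬝ᵥ vecPart (hol U p))
            + 2 * scalarPart (hol U p) * ∑ c, covCurl U (linkVec L W) (p, c) * transportCross W U p c)|
      ≤ (Fintype.card (Plaquette 3 L) : ℝ) * (1239300 * τ ^ 4 + 27540 * τ ^ 3 * Real.sqrt σ) := by
  rw [wilsonAction_step_eq, Finset.mul_sum, ← Finset.sum_sub_distrib, ← Finset.sum_sub_distrib, ← Finset.sum_sub_distrib]
  refine (Finset.abs_sum_le_sum_abs _ _).trans ?_
  calc ∑ p : Plaquette 3 L, |2 * (1 - scalarPart (transportStep W U p)) * scalarPart (hol U p)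
          + 2 * (vecPart (transportStep W U p) ⬝ᵥ vecPart (hol U p))
          - 2 * ∑ c, covCurl U (linkVec L W) (p, c) * plaqCurv U (p, c)
          - scalarPart (hol U p) * ∑ c, covCurl U (linkVec L W) (p, c) ^ 2
          - (2 * (transportCross W U p ⬝ᵥ vecPart (hol U p))
              + 2 * scalarPart (hol U p) * ∑ c, covCurl U (linkVec L W) (p, c) * transportCross W U p c)|
      ≤ ∑ _p : Plaquette 3 L, (1239300 * τ ^ 4 + 27540 * τ ^ 3 * Real.sqrt σ) := Finset.sum_le_sum fun p _ => by
        have h := abs_plaqIncrement_sub_cubic_le W U hτ hσ hS hs hw p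
        have e : 2 * (1 - scalarPart (transportStep W U p)) * scalarPart (hol U p)
            + 2 * (vecPart (transportStep W U p) ⬝ᵥ vecPart (hol U p))
            - 2 * ∑ c, covCurl U (linkVec L W) (p, c) * plaqCurv U (p, c)
            - scalarPart (hol U p) * ∑ c, covCurl U (linkVec L W) (p, c) ^ 2
            - (2 * (transportCross W U p ⬝ᵥ vecPart (hol U p))
                + 2 * scalarPart (hol U p) * ∑ c, covCurl U (linkVec L W) (p, c) * transportCross W U p c)
            = (2 * (1 - scalarPart (transportStep W U p)) * scalarPart (hol U p)
                + 2 * (vecPart (transportStep W U p) ⬝ᵥ vecPart (hol U p)))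
              - (2 * ∑ c, covCurl U (linkVec L W) (p, c) * plaqCurv U (p, c)
                  + scalarPart (hol U p) * ∑ c, covCurl U (linkVec L W) (p, c) ^ 2)
              - (2 * (transportCross W U p ⬝ᵥ vecPart (hol U p))
                  + 2 * scalarPart (hol U p) * ∑ c, covCurl U (linkVec L W) (p, c) * transportCross W U p c) := by ring
        rw [e]; exact h
    _ = (Fintype.card (Plaquette 3 L) : ℝ) * (1239300 * τ ^ 4 + 27540 * τ ^ 3 * Real.sqrt σ) := by
        rw [Finset.sum_const, Finset.card_univ, nsmul_eq_mul]

end Summit.QuantumFields.YangMills.Theorems.FemtoTransferGap.StepCubic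

end
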